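import Mathlib
import HarnessLib
import Summits.HubbardSuperconductivity.HubbardSuperconductivity.Theorems.KLProgrammeKLRegimeEngineV8E5Block

/-!
# Route `KLProgramme` — ENGINE child gen 8 (stmt-HubbardSuperconductivity-20437 `KLRegimeEngineV17F2`), SKELETON v2 class #3, PROVING side:
# the E.5 block through the TRIVIAL sectorisation (first steps `n ≤ 2`, where no thin family covers the lines and no sector gain is needed)
# (cell gate-hubbard-kl, seat p5 g7; instance of `…EngineV8E5Block` §2 (p544244))

For the step `n−1 → n` with `n ≤ 2` the lines of the E.5 block live up to `t < Λ_{n−1} ≥ Λ_1`, above the plateau of every thin family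
(`klAnisoFamily m`: `{t ≤ Λ_{m+1}}`), and the target `C·(P.Klam·U)³·2^{−n}` asks for no scale gain (`2^{−n} ≥ 1/4`).  The bridge is then run with the
ONE-sector family `trivialMultiplier L M = fun _ _ => 1` (Literature `SectorisedKernelNorm`), whose plateau is everything:

* `trivialMultiplier` as a thin/fat pair: `trivialMultiplier_mul_self`, `sum_trivialMultiplier` (`= 1`), multiplicity / overlap `1`, `‖·‖ ≤ 1`,
  row sums `Σ_Y ‖S(1) K Y‖ ≤ (βL²)⁻¹·|SpaceTimeIdx|` (`sum_norm_sectorSubMatrix_le`);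
* **`norm_klE5Block_le_of_tails_trivial`** — `‖klE5Block … κ V Λ Qm x y‖ ≤ 4!·|βL²|³·((βL²)⁻¹|SpaceTimeIdx|)⁴·Σ_s T s` at ANY labels, with `T s` the
  colouring-wise tails of the UNSECTORISED two-vertex terms (`sectorPreimage β trivialMultiplier W_Λ`: position-space kernels, `sectorisedKernel_trivialMultiplier`);
  `hT` is `klE5_tail_le_of_lineData` (p544244 §4) at `F = F̃ = trivialMultiplier`, `ρ₀ = 1`, whose level norms are plain `L¹–L^∞` kernel norms.

Pure composition; no definitions, no named facts; nothing about the model's sizes is asserted; nothing asserts superconductivity.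
-/

noncomputable section

namespace Summit.HubbardSuperconductivity.HubbardSuperconductivity.Theorems.KLRegimeSplit

set_option linter.dupNamespace false -- summit = problem name (single-conjunct summit), D-0017

open Real Finset Literature.MathematicalPhysics.QuantumLattice Literature.Probability.LatticeModels GrassmannAlgebra Matrix
open Summit.HubbardSuperconductivity.HubbardSuperconductivity.Theorems.KLRegimeWick

/-! ## §1 The trivial family as a thin/fat pair -/

section Trivial

variable {L M : ℕ}

/-- `1 · 1 = 1`: the trivial family is its own fat partner. -/
theorem trivialMultiplier_mul_self (ω : Fin 1) (k : FreqMomentum L M) :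
    trivialMultiplier L M ω k * trivialMultiplier L M ω k = trivialMultiplier L M ω k := by
  simp [trivialMultiplier]

/-- The plateau of the trivial family is everything: `Σ_ω 1 = 1`. -/
theorem sum_trivialMultiplier (k : FreqMomentum L M) : ∑ ω, trivialMultiplier L M ω k = 1 := by
  simp [trivialMultiplier]

/-- `Σ_ω F_ω = 0 ⇒ F_ω = 0` holds vacuously (the sum is `1`). -/
theorem trivialMultiplier_eq_zero_of_sum_eq_zero (k : FreqMomentum L M) (h : ∑ ω, trivialMultiplier L M ω k = 0) (ω : Fin 1) :
    trivialMultiplier L M ω k = 0 := by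
  rw [sum_trivialMultiplier] at h
  exact absurd h one_ne_zero

/-- `‖1‖ ≤ 1`. -/
theorem norm_trivialMultiplier_le_one (ω : Fin 1) (k : FreqMomentum L M) : ‖trivialMultiplier L M ω k‖ ≤ 1 := by
  simp [trivialMultiplier]

/-- Multiplicity `1`. -/
theorem card_filter_trivialMultiplier_ne_zero_le (k : FreqMomentum L M) :
    ((univ : Finset (Fin 1)).filter fun ω => trivialMultiplier L M ω k ≠ 0).card ≤ 1 :=
  (card_filter_le _ _).trans (by simp)

variable [NeZero L]

/-- Overlap `1`. -/
theorem card_filter_overlap_trivialMultiplier_le (ω : Fin 1) :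
    ((univ : Finset (Fin 1)).filter fun ω' => ∃ q, trivialMultiplier L M ω q * trivialMultiplier L M ω' q ≠ 0).card ≤ 1 :=
  (card_filter_le _ _).trans (by simp)

/-- Row sums of the trivial substitution: `Σ_Y ‖S(1) K Y‖ ≤ (βL²)⁻¹·|SpaceTimeIdx|`. -/
theorem sum_norm_sectorSubMatrix_trivialMultiplier_le (β : ℝ) (K : HubbardFieldIdx L M) :
    ∑ Y, ‖sectorSubMatrix L M β (trivialMultiplier L M) K Y‖ ≤ ‖((1 / (β * (L : ℝ) ^ 2) : ℝ) : ℂ)‖ * Fintype.card (SpaceTimeIdx L M) := by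
  have h := sum_norm_sectorSubMatrix_le β (trivialMultiplier L M) norm_trivialMultiplier_le_one card_filter_trivialMultiplier_ne_zero_le K
  simpa using h

end Trivial

/-! ## §2 The block through the trivial sectorisation -/

section Block

variable {L M : ℕ} [NeZero L] [NeZero M] (β μ : ℝ) (K : TrigPolyC4v) (n₀ : ℕ) (κ : FreqMomentum L M × Fin 2 → ℂ)
  (V : HubbardGrassmann L M) (Λ : ℝ) (Qm : TorusSite 2 L) (x y : TorusSite 2 L × MatsubaraIdx M)

/-- **The E.5 block through the trivial sectorisation** (steps `n ≤ 2`; any labels, any `Λ`): `norm_klE5Block_le_of_tails` at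
`F = F̃ = trivialMultiplier` — no plateau hypothesis survives, `R₁ = (βL²)⁻¹·|SpaceTimeIdx|`. [cite: BenfattoGiulianiMastropietro2006, §2.7 (2.70)] -/
theorem norm_klE5Block_le_of_tails_trivial (hβ : β ≠ 0) (T : (Fin 4 → Fin 2) → ℝ) (hT0 : ∀ s, 0 ≤ T s)
    (hT : ∀ (s : Fin 4 → Fin 2) (Z : Fin 4 → SpaceTimeIdx L M × SectorLeg 1),
      ∑ i ∈ Finset.Icc 2 (Fintype.card (HubbardFieldIdx L M × Fin 2) + 1), ((i.factorial : ℝ))⁻¹ *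
        ‖kernel ℂ ((grassmannLaplacian ℂ (crossCov ℂ ((sectorSubMatrix L M β (trivialMultiplier L M)).transpose *
              (klE5Total L M β μ K n₀ κ - klE5DressedSlice L M β μ K n₀ κ Λ) * sectorSubMatrix L M β (trivialMultiplier L M))) ^ i *
            grassmannLaplacian ℂ (crossCov ℂ ((sectorSubMatrix L M β (trivialMultiplier L M)).transpose * klE5DressedSliceDeriv L M β μ K n₀ κ Λ *
              sectorSubMatrix L M β (trivialMultiplier L M))))
          (dblCopy ℂ 0 (sectorPreimage β (trivialMultiplier L M) (klE5Carrier L M β μ K n₀ κ V Λ)) *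
            dblCopy ℂ 1 (sectorPreimage β (trivialMultiplier L M) (klE5Carrier L M β μ K n₀ κ V Λ)))) 4 (fun j => (Z j, s j))‖ ≤ T s) :
    ‖klE5Block L M β μ K n₀ κ V Λ Qm x y‖ ≤ ((4 : ℕ).factorial : ℝ) * |β * (L : ℝ) ^ 2| ^ 3 *
      ((‖((1 / (β * (L : ℝ) ^ 2) : ℝ) : ℂ)‖ * Fintype.card (SpaceTimeIdx L M)) ^ 4 * ∑ s : Fin 4 → Fin 2, T s) :=
  norm_klE5Block_le_of_tails β μ K n₀ κ V Λ Qm x y hβ (trivialMultiplier L M) (trivialMultiplier L M) trivialMultiplier_mul_self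
    trivialMultiplier_eq_zero_of_sum_eq_zero (fun _ _ _ => ⟨sum_trivialMultiplier _, sum_trivialMultiplier _⟩)
    (fun _ _ _ => ⟨sum_trivialMultiplier _, sum_trivialMultiplier _⟩) (sum_trivialMultiplier _) (sum_trivialMultiplier _) (sum_trivialMultiplier _)
    (sum_trivialMultiplier _) (sum_norm_sectorSubMatrix_trivialMultiplier_le β) T hT0 hT

end Block

end Summit.HubbardSuperconductivity.HubbardSuperconductivity.Theorems.KLRegimeSplit

end
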